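import Summits.KontsevichZagierPeriods.Zeta5Search.Certificates.VIMInnerModuleN
import HarnessLib

/-!
# ζ(5) search — brown9 LEVEL 1: the polynomial binomial `bp` agrees with `Nat.choose`; integer form of `T(n;p,q)` (cell `pub-zeta5`, certifier `cert-1`)

HONEST FRAMING: systematic search; no irrationality claim unless certified.

Bridge from the rational-parameter module `VIMInner.T n p q` (`Certificates/VIMInnerModule(N).lean`, relations
P2/M3/M4/N1 proved for all `p q : ℚ`) to the integer binomial sums of fam-brown9 / the ttrl2 lane:
* `bp_natCast` — `bp m (x : ℚ) = C(x,m)` for ALL naturals `x` (`= 0` when `x < m`): the lane's convention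
  "C(x,n) := x(x−1)⋯(x−n+1)/n!, = 0 for 0 ≤ x < n" is literally `Nat.choose` on naturals;
* `tT_natCast` — for `k ≤ p`, `k ≤ q`: `t(n;p,q;k) = (−1)^k C(n,k) C(p−k,n) C(q−k,n)` with `ℕ` binomials;
* `T_natCast` — for naturals `p, q ≥ n`: `T(n;p,q) = Σ_{k≤n} (−1)^k C(n,k) C(p−k,n) C(q−k,n)` (all `ℕ`-subtractions genuine);
* `T_two_five_seven : T 2 5 7 = 60` — a kernel-evaluated sanity value (`10·21 − 2·6·15 + 3·10`).
So every relation of the module files specialises to the integer sums `Σ_k (−1)^k C(n,k)C(p−k,n)C(q−k,n)` appearing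
in `A(n)` (Cells/VanishingMiddleLeading, FAMILY.md §2(c)) at all lattice points `p, q ≥ n`. No named facts.
-/

namespace Summit.KontsevichZagierPeriods.Zeta5Search.Certificates

namespace VIMInner

open Finset
open Summit.KontsevichZagierPeriods.Zeta5Search.SymmetricRecursion (choose_succ_right_cast)

/-- **`bp m x = C(x,m)` at naturals** (including `x < m`, where both vanish). -/
theorem bp_natCast (m x : ℕ) : bp m (x : ℚ) = ((x.choose m : ℕ) : ℚ) := by
  induction m with
  | zero => simp [bp, fallProd]
  | succ m ih =>
    have h := choose_succ_right_cast x m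
    have hm : ((m.factorial : ℕ) : ℚ) ≠ 0 := by positivity
    have hm1 : ((m : ℚ) + 1) ≠ 0 := by positivity
    unfold bp at ih ⊢
    rw [fallProd_succ, Nat.factorial_succ]
    push_cast
    rw [div_eq_iff hm] at ih
    rw [div_eq_iff (mul_ne_zero hm1 hm)]
    -- `fallProd m x · (x − m) = C(x,m+1) · ((m+1) · m!)`
    linear_combination ((x : ℚ) - m) * ih + ((m.factorial : ℕ) : ℚ) * (-h)

/-- **Integer form of the summand**: for `k ≤ p`, `k ≤ q`,
`t(n;p,q;k) = (−1)^k C(n,k) C(p−k,n) C(q−k,n)` (`ℕ` binomials, genuine subtractions). -/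
theorem tT_natCast (n p q k : ℕ) (hp : k ≤ p) (hq : k ≤ q) :
    tT n p q k = (-1) ^ k * ((n.choose k : ℕ) : ℚ) * (((p - k).choose n : ℕ) : ℚ) * (((q - k).choose n : ℕ) : ℚ) := by
  unfold tT
  rw [show (p : ℚ) - k = ((p - k : ℕ) : ℚ) by push_cast [hp]; ring,
    show (q : ℚ) - k = ((q - k : ℕ) : ℚ) by push_cast [hq]; ring, bp_natCast, bp_natCast]

/-- **Integer form of the inner block** at lattice points `p, q ≥ n`:
`T(n;p,q) = Σ_{k ≤ n} (−1)^k C(n,k) C(p−k,n) C(q−k,n)`. -/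
theorem T_natCast (n p q : ℕ) (hp : n ≤ p) (hq : n ≤ q) :
    T n p q = ∑ k ∈ range (n + 1),
      (-1) ^ k * ((n.choose k : ℕ) : ℚ) * (((p - k).choose n : ℕ) : ℚ) * (((q - k).choose n : ℕ) : ℚ) := by
  unfold T
  refine sum_congr rfl fun k hk => ?_
  have hk' : k ≤ n := Nat.lt_succ_iff.mp (mem_range.mp hk)
  exact tT_natCast n p q k (hk'.trans hp) (hk'.trans hq)

/-- Sanity value: `T(2;5,7) = C(5,2)C(7,2) − 2·C(4,2)C(6,2) + C(3,2)C(5,2) = 210 − 180 + 30 = 60`. -/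
theorem T_two_five_seven : T 2 5 7 = 60 := by
  have h := T_natCast 2 5 7 (by norm_num) (by norm_num)
  push_cast at h
  rw [h]
  simp [Finset.sum_range_succ, Nat.choose]
  norm_num

/-- The relations specialise to lattice points: e.g. (M4) at naturals `p, q ≥ n ≥ 1` in `ℕ`-binomial form. -/
theorem T_rel_M4_nat (n p q : ℕ) (hn : 1 ≤ n) :
    ((p : ℚ) - q) * T n p q + ((n : ℚ) - p + q) * T n (p + 1) q - ((n : ℚ) + p - q) * T n p (q + 1)
      + ((p : ℚ) - q) * T n (p + 1) (q + 1) = 0 := by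
  exact T_rel_M4 n hn (p : ℚ) (q : ℚ)

end VIMInner

end Summit.KontsevichZagierPeriods.Zeta5Search.Certificates
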